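import Summits.Ventures.PercRepro.HyperplaneKeyUpwardRowNine
import Summits.Ventures.PercRepro.HyperplaneKeyWindowTails
import Summits.Ventures.PercRepro.S4MidKeyTen
import Summits.Ventures.PercRepro.S4MidKeyEleven
import Summits.Ventures.PercRepro.S4MidKeyTwelve
import Summits.Ventures.PercRepro.S4MidKeyThirteen
import Summits.Ventures.PercRepro.S4MidKeyFourteen
import Summits.Ventures.PercRepro.S4MidKeyFifteen
import Summits.Ventures.PercRepro.S4MidKeySixteen
import Summits.Ventures.PercRepro.S4MidKeySeventeen
import Summits.Ventures.PercRepro.S4MidKeyEighteen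
import Summits.Ventures.PercRepro.S4MidKeyNineteen
import Summits.Ventures.PercRepro.S4MidKeyTwenty
import Summits.Ventures.PercRepro.S4MidKeyTwentyone
import Summits.Ventures.PercRepro.S4MidKeyTwentytwo
import Summits.Ventures.PercRepro.S4MidKeyTwentythree
import Summits.Ventures.PercRepro.S4MidKeyTwentyfour
import Summits.Ventures.PercRepro.S4MidKeyTwentyfive
import Summits.Ventures.PercRepro.S4MidKeyTwentysix
import Summits.Ventures.PercRepro.S4MidKeyTwentyseven
import Summits.Ventures.PercRepro.S4MidKeyTwentyeight
import Summits.Ventures.PercRepro.S4MidKeyTwentynine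
import Summits.Ventures.PercRepro.S4MidKeyThirty
import Summits.Ventures.PercRepro.S4MidKeyThirtyone

/-!
# PercRepro — THE LEVEL-`7` WINDOW TAIL, WITHOUT A RANK HYPOTHESIS: `n ≥ 166` FOR EVERY ROW `9 ≤ p ≤ 104` (p1, gen 45; an S4 feeder — p9 owns SUBCLAIM-S4; no window claim here)

The dispatch of the tails of record after this gen: the upward row `9` (`88`), the middle-key rows `10 … 31` (`85 … 123`, S4MidKey*), the size
rows `32 … 104` (`133 → 118 → 166`); the maximum is `166` at `p = 104`. None of these needs `ρ(E) = p`, so neither does the dispatch: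
**every `e`-free matroid of rank `p` in the level-`7` window on `n ≥ 166` points satisfies `RLS M p 7`** (before: `202`, with the rank hypothesis).
The open cells of the window are the core cells `(p, d)` with `8 ≤ d ≤ n₀(p) − p` per row. Coloops are not excluded. Axioms: standard.
-/

open scoped Matroid

namespace PercRepro

namespace HypKey

open Set

variable {α : Type}

/-- **The level-`7` window's tail is one number, without a rank hypothesis**: `e`-free, `9 ≤ p ≤ 104`, `n ≥ 166` give `RLS M p 7`. -/
theorem c025_core_seven_window_tail'' (M : Matroid α) [M.Finite] (p : ℕ) (hp : 9 ≤ p) (hp' : p ≤ 104)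
    (hn : 166 ≤ M.E.ncard)
    (hfree : ∀ e ∈ M.E, ∃ A ⊆ M.E \ {e}, e ∉ M.closure A ∧ e ∉ M.closure ((M.E \ {e}) \ A)) :
    ThmN.RLS M p 7 := by
  interval_cases p
  · exact c025_core_seven_upward_9 M (by omega) hfree
  · exact S4Mid.c025_core_seven_midkey_ten M (by omega) hfree
  · exact S4Mid.c025_core_seven_midkey_eleven M (by omega) hfree
  · exact S4Mid.c025_core_seven_midkey_twelve M (by omega) hfree
  · exact S4Mid.c025_core_seven_midkey_thirteen M (by omega) hfree
  · exact S4Mid.c025_core_seven_midkey_fourteen M (by omega) hfree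
  · exact S4Mid.c025_core_seven_midkey_fifteen M (by omega) hfree
  · exact S4Mid.c025_core_seven_midkey_sixteen M (by omega) hfree
  · exact S4Mid.c025_core_seven_midkey_seventeen M (by omega) hfree
  · exact S4Mid.c025_core_seven_midkey_eighteen M (by omega) hfree
  · exact S4Mid.c025_core_seven_midkey_nineteen M (by omega) hfree
  · exact S4Mid.c025_core_seven_midkey_twenty M (by omega) hfree
  · exact S4Mid.c025_core_seven_midkey_twentyone M (by omega) hfree
  · exact S4Mid.c025_core_seven_midkey_twentytwo M (by omega) hfree
  · exact S4Mid.c025_core_seven_midkey_twentythree M (by omega) hfree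
  · exact S4Mid.c025_core_seven_midkey_twentyfour M (by omega) hfree
  · exact S4Mid.c025_core_seven_midkey_twentyfive M (by omega) hfree
  · exact S4Mid.c025_core_seven_midkey_twentysix M (by omega) hfree
  · exact S4Mid.c025_core_seven_midkey_twentyseven M (by omega) hfree
  · exact S4Mid.c025_core_seven_midkey_twentyeight M (by omega) hfree
  · exact S4Mid.c025_core_seven_midkey_twentynine M (by omega) hfree
  · exact S4Mid.c025_core_seven_midkey_thirty M (by omega) hfree
  · exact S4Mid.c025_core_seven_midkey_thirtyone M (by omega) hfree
  · exact c025_core_seven_size_key_32 M (by omega) hfree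
  · exact c025_core_seven_size_key_33 M (by omega) hfree
  · exact c025_core_seven_size_key_34 M (by omega) hfree
  · exact c025_core_seven_size_key_35 M (by omega) hfree
  · exact c025_core_seven_size_key_36 M (by omega) hfree
  · exact c025_core_seven_size_key_37 M (by omega) hfree
  · exact c025_core_seven_size_key_38 M (by omega) hfree
  · exact c025_core_seven_size_key_39 M (by omega) hfree
  · exact c025_core_seven_size_key_40 M (by omega) hfree
  · exact c025_core_seven_size_key_41 M (by omega) hfree
  · exact c025_core_seven_size_key_42 M (by omega) hfree
  · exact c025_core_seven_size_key_43 M (by omega) hfree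
  · exact c025_core_seven_size_key_44 M (by omega) hfree
  · exact c025_core_seven_size_key_45 M (by omega) hfree
  · exact c025_core_seven_size_key_46 M (by omega) hfree
  · exact c025_core_seven_size_key_47 M (by omega) hfree
  · exact c025_core_seven_size_key_48 M (by omega) hfree
  · exact c025_core_seven_size_key_49 M (by omega) hfree
  · exact c025_core_seven_size_key_50 M (by omega) hfree
  · exact c025_core_seven_size_key_51 M (by omega) hfree
  · exact c025_core_seven_size_key_52 M (by omega) hfree
  · exact c025_core_seven_size_key_53 M (by omega) hfree
  · exact c025_core_seven_size_key_54 M (by omega) hfree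
  · exact c025_core_seven_size_key_55 M (by omega) hfree
  · exact c025_core_seven_size_key_56 M (by omega) hfree
  · exact c025_core_seven_size_key_57 M (by omega) hfree
  · exact c025_core_seven_size_key_58 M (by omega) hfree
  · exact c025_core_seven_size_key_59 M (by omega) hfree
  · exact c025_core_seven_size_key_60 M (by omega) hfree
  · exact c025_core_seven_size_key_61 M (by omega) hfree
  · exact c025_core_seven_size_key_62 M (by omega) hfree
  · exact c025_core_seven_size_key_63 M (by omega) hfree
  · exact c025_core_seven_size_key_64 M (by omega) hfree
  · exact c025_core_seven_size_key_65 M (by omega) hfree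
  · exact c025_core_seven_size_key_66 M (by omega) hfree
  · exact c025_core_seven_size_key_67 M (by omega) hfree
  · exact c025_core_seven_size_key_68 M (by omega) hfree
  · exact c025_core_seven_size_key_69 M (by omega) hfree
  · exact c025_core_seven_size_key_70 M (by omega) hfree
  · exact c025_core_seven_size_key_71 M (by omega) hfree
  · exact c025_core_seven_size_key_72 M (by omega) hfree
  · exact c025_core_seven_size_key_73 M (by omega) hfree
  · exact c025_core_seven_size_key_74 M (by omega) hfree
  · exact c025_core_seven_size_key_75 M (by omega) hfree
  · exact c025_core_seven_size_key_76 M (by omega) hfree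
  · exact c025_core_seven_size_key_77 M (by omega) hfree
  · exact c025_core_seven_size_key_78 M (by omega) hfree
  · exact c025_core_seven_size_key_79 M (by omega) hfree
  · exact c025_core_seven_size_key_80 M (by omega) hfree
  · exact c025_core_seven_size_key_81 M (by omega) hfree
  · exact c025_core_seven_size_key_82 M (by omega) hfree
  · exact c025_core_seven_size_key_83 M (by omega) hfree
  · exact c025_core_seven_size_key_84 M (by omega) hfree
  · exact c025_core_seven_size_key_85 M (by omega) hfree
  · exact c025_core_seven_size_key_86 M (by omega) hfree
  · exact c025_core_seven_size_key_87 M (by omega) hfree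
  · exact c025_core_seven_size_key_88 M (by omega) hfree
  · exact c025_core_seven_size_key_89 M (by omega) hfree
  · exact c025_core_seven_size_key_90 M (by omega) hfree
  · exact c025_core_seven_size_key_91 M (by omega) hfree
  · exact c025_core_seven_size_key_92 M (by omega) hfree
  · exact c025_core_seven_size_key_93 M (by omega) hfree
  · exact c025_core_seven_size_key_94 M (by omega) hfree
  · exact c025_core_seven_size_key_95 M (by omega) hfree
  · exact c025_core_seven_size_key_96 M (by omega) hfree
  · exact c025_core_seven_size_key_97 M (by omega) hfree
  · exact c025_core_seven_size_key_98 M (by omega) hfree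
  · exact c025_core_seven_size_key_99 M (by omega) hfree
  · exact c025_core_seven_size_key_100 M (by omega) hfree
  · exact c025_core_seven_size_key_101 M (by omega) hfree
  · exact c025_core_seven_size_key_102 M (by omega) hfree
  · exact c025_core_seven_size_key_103 M (by omega) hfree
  · exact c025_core_seven_size_key_104 M (by omega) hfree

end HypKey

end PercRepro
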